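import Mathlib
import Summits.Ventures.PercRepro2.TypedSplit
import Summits.Ventures.PercRepro2.TypedPendant
import Summits.Ventures.PercRepro2.TypedSpectator

/-!
# Typed-base reductions: the PENDANT ROOT — the exact typed root-leaf identity (blind cell
PercRepro2, mine-2 g50, 2026-08-29; `conjectures/MINE-2.md` M2-106; g49's successor item (ii))

Night-3's leaf rules (`TypedPendant.lean`) are multiplicative for the marks `o, b` and an
unmarked leaf; for a ROOT there is no multiplicative rule (`a₁` sits in every kernel term).  What
holds instead is an EXACT reduction: when the root `a₁` is a leaf attached by the single typed
edge `f = {a₁, u}`, closing `f` in a copy isolates `a₁` in that copy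
(`st_update_pendant_a1`: the state is `killA1` of the state with `f` open — `q′ = L_o = L_b = L₃ =
false`, the `a₂`-coordinates untouched), so by `typedCount_split`
**`typedCount_pendant_a1`**: `N_τ(G) = Σ_{(a,b,c) ∈ Bool³, a+b+c = τ f} N′(KBk1 a b c)` — the typed
count on `G − a₁` (the edge `f` pinned closed, `a₁ := u` in the copies where it is open) of the
pendant-root kernels `KBk1 a b c x y w = KB (cond a x (killA1 x)) …`.  For `τ f = 1` and `τ f = 2`
the three placements (`typedCount_pendant_a1_one / _two`), and by the copy symmetry of the typed
count (`typedCount_swap12 / 23 / 13`, types in `{1, 2}`) ONE kernel each: **`KA1one`** (the open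
copy in each of the three slots, the other two with `a₁` isolated) and **`KA1two`**
(`typedCount_pendant_a1_eq_KA1one / _KA1two`).  This is the typed analogue of p4's root-leaf cubic
`Gc = (1−q)³T0 + q(1−q)²T1 + q²(1−q)T2 + q³Gc(a₁ := u)` (`RootLeafUTheorem`): the typed counts of
`KA1one` / `KA1two` are the typed (Bernstein-coefficient) forms of `T1` / `T2`, and row 2′TRI on the
pendant-root class is their nonnegativity.  Through `orbitRootS_pendant_two / _one`
(`SepSplitPendant`) the single-edge-bundle chain orbit sums with a far ROOT are twice these counts
(`SepSplitPendantRoot`).  Mirror for `a₂` (`killA2`, `st_update_pendant_a2`,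
`typedCount_pendant_a2`).  Own work; standard axioms.
-/

namespace Summit.Ventures.PercRepro2

namespace CovForm

namespace TypedRed

open OneTyped TypedA3

/-! ## States at a pendant root -/

section States

open Classical

variable {V : Type*} {E : Type*} [DecidableEq E]

/-- The state with the root `a₁` isolated (`q′ = L_o = L_b = L₃ = false`). -/
def killA1 (s : St) : St := (false, false, s.2.2.1, false, s.2.2.2.2.1, false, s.2.2.2.2.2.2)

/-- The state with the root `a₂` isolated (`q′ = H_o = H_b = H₃ = false`). -/
def killA2 (s : St) : St := (false, s.2.1, false, s.2.2.2.1, false, s.2.2.2.2.2.1, false)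

/-- **The pendant-root kernel at `a₁`** for the pattern `(a, b, c)` of the leaf edge: the copies in
which the edge is closed have `a₁` isolated. -/
def KBk1 (a b c : Bool) (x y z : St) : ℤ :=
  KB (cond a x (killA1 x)) (cond b y (killA1 y)) (cond c z (killA1 z))

/-- **The pendant-root kernel at `a₂`** for the pattern `(a, b, c)` of the leaf edge. -/
def KBk2 (a b c : Bool) (x y z : St) : ℤ :=
  KB (cond a x (killA2 x)) (cond b y (killA2 y)) (cond c z (killA2 z))

/-- **The type-`1` pendant-root kernel**: the copy `x` has `a₁` attached, placed in each of the
three slots; `y, w` have `a₁` isolated. -/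
def KA1one (x y w : St) : ℤ :=
  KB x (killA1 y) (killA1 w) + KB (killA1 y) x (killA1 w) + KB (killA1 y) (killA1 w) x

/-- **The type-`2` pendant-root kernel**: the copy `x` has `a₁` isolated, placed in each of the
three slots; `y, w` have `a₁` attached. -/
def KA1two (x y w : St) : ℤ :=
  KB (killA1 x) y w + KB y (killA1 x) w + KB y w (killA1 x)

variable (ends : E → Sym2 V) (o a₁ a₂ a₃ b : V)

/-- At a pendant root `a₁` (a leaf carrying exactly the mark `a₁`), closing the leaf edge isolates
`a₁`: the state is `killA1` of the state with the edge open. -/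
lemma st_update_pendant_a1 {f : E} {u : V} (hf : ends f = s(a₁, u))
    (hleaf : ∀ e, a₁ ∈ ends e → e = f) (h1u : a₁ ≠ u) (h1o : a₁ ≠ o) (h12 : a₁ ≠ a₂)
    (h13 : a₁ ≠ a₃) (h1b : a₁ ≠ b) (x : Config E) :
    st ends o a₁ a₂ a₃ b (Function.update x f false) =
      killA1 (st ends o a₁ a₂ a₃ b (Function.update x f true)) := by
  unfold st killA1
  simp only [Prod.mk.injEq]
  have hF : Function.update x f false f = false := Function.update_self f false x
  refine ⟨?_, ?_, ?_, ?_, ?_, ?_, ?_⟩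
  · exact decide_eq_false fun h => h12 (conn_leaf_closed hf hleaf h1u hF (conn_symm h)).symm
  · exact decide_eq_false fun h => h1o (conn_leaf_closed hf hleaf h1u hF h).symm
  · exact decide_eq_decide.mpr ((conn_update_leaf_iff hf hleaf h1u false h12.symm h1o.symm).trans
      (conn_update_leaf_iff hf hleaf h1u true h12.symm h1o.symm).symm)
  · exact decide_eq_false fun h => h1b (conn_leaf_closed hf hleaf h1u hF h).symm
  · exact decide_eq_decide.mpr ((conn_update_leaf_iff hf hleaf h1u false h12.symm h1b.symm).trans
      (conn_update_leaf_iff hf hleaf h1u true h12.symm h1b.symm).symm)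
  · exact decide_eq_false fun h => h13 (conn_leaf_closed hf hleaf h1u hF h).symm
  · exact decide_eq_decide.mpr ((conn_update_leaf_iff hf hleaf h1u false h12.symm h13.symm).trans
      (conn_update_leaf_iff hf hleaf h1u true h12.symm h13.symm).symm)

/-- At a pendant root `a₂`, closing the leaf edge isolates `a₂`. -/
lemma st_update_pendant_a2 {f : E} {u : V} (hf : ends f = s(a₂, u))
    (hleaf : ∀ e, a₂ ∈ ends e → e = f) (h2u : a₂ ≠ u) (h2o : a₂ ≠ o) (h21 : a₂ ≠ a₁)
    (h23 : a₂ ≠ a₃) (h2b : a₂ ≠ b) (x : Config E) :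
    st ends o a₁ a₂ a₃ b (Function.update x f false) =
      killA2 (st ends o a₁ a₂ a₃ b (Function.update x f true)) := by
  unfold st killA2
  simp only [Prod.mk.injEq]
  have hF : Function.update x f false f = false := Function.update_self f false x
  refine ⟨?_, ?_, ?_, ?_, ?_, ?_, ?_⟩
  · exact decide_eq_false fun h => h21 (conn_leaf_closed hf hleaf h2u hF h).symm
  · exact decide_eq_decide.mpr ((conn_update_leaf_iff hf hleaf h2u false h21.symm h2o.symm).trans
      (conn_update_leaf_iff hf hleaf h2u true h21.symm h2o.symm).symm)
  · exact decide_eq_false fun h => h2o (conn_leaf_closed hf hleaf h2u hF h).symm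
  · exact decide_eq_decide.mpr ((conn_update_leaf_iff hf hleaf h2u false h21.symm h2b.symm).trans
      (conn_update_leaf_iff hf hleaf h2u true h21.symm h2b.symm).symm)
  · exact decide_eq_false fun h => h2b (conn_leaf_closed hf hleaf h2u hF h).symm
  · exact decide_eq_decide.mpr ((conn_update_leaf_iff hf hleaf h2u false h21.symm h23.symm).trans
      (conn_update_leaf_iff hf hleaf h2u true h21.symm h23.symm).symm)
  · exact decide_eq_false fun h => h23 (conn_leaf_closed hf hleaf h2u hF h).symm

end States

/-! ## The typed root-leaf identity -/

section Identity

variable {V : Type*} {E : Type*} [Fintype E] [DecidableEq E] {R : Type*} [Field R]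
variable (ends : E → Sym2 V) (o a₁ a₂ a₃ b : V)

/-- **THE TYPED ROOT-LEAF IDENTITY at `a₁`**: with `a₁` a leaf at the typed edge `f = {a₁, u}`, the
typed count is the sum over the patterns `(a, b, c)` of `f` with `a + b + c = τ f` of the typed
counts over `F ∖ {f}` (with `f` pinned closed) of the pendant-root kernels on the states with `f`
open (`a₁ := u`). -/
theorem typedCount_pendant_a1 {f : E} {u : V} (hf : ends f = s(a₁, u))
    (hleaf : ∀ e, a₁ ∈ ends e → e = f) (h1u : a₁ ≠ u) (h1o : a₁ ≠ o) (h12 : a₁ ≠ a₂)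
    (h13 : a₁ ≠ a₃) (h1b : a₁ ≠ b) (F : Finset E) (hfF : f ∈ F) (z : Config E) (τ : E → ℕ) :
    typedCount F z τ (K3 ends o a₁ a₂ a₃ b : Config E → Config E → Config E → R) =
      ∑ p : Bool, ∑ q : Bool, ∑ r : Bool,
        if p.toNat + q.toNat + r.toNat = τ f then
          typedCount (F.erase f) (Function.update z f false) τ
            (fun x y w => ((KBk1 p q r (st ends o a₁ a₂ a₃ b (Function.update x f true))
              (st ends o a₁ a₂ a₃ b (Function.update y f true))
              (st ends o a₁ a₂ a₃ b (Function.update w f true)) : ℤ) : R))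
        else 0 := by
  have hst : ∀ (x : Config E) (p : Bool), st ends o a₁ a₂ a₃ b (Function.update x f p) =
      cond p (st ends o a₁ a₂ a₃ b (Function.update x f true))
        (killA1 (st ends o a₁ a₂ a₃ b (Function.update x f true))) := by
    intro x p
    cases p
    · exact st_update_pendant_a1 ends o a₁ a₂ a₃ b hf hleaf h1u h1o h12 h13 h1b x
    · rfl
  rw [typedCount_split F f hfF]
  refine Finset.sum_congr rfl fun p _ => Finset.sum_congr rfl fun q _ =>
    Finset.sum_congr rfl fun r _ => ?_
  split_ifs
  · refine typedCount_congr_K _ _ _ fun x y w => ?_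
    rw [K3_eq_KB, hst x p, hst y q, hst w r]
    rfl
  · rfl

/-- **The typed root-leaf identity at `a₂`.** -/
theorem typedCount_pendant_a2 {f : E} {u : V} (hf : ends f = s(a₂, u))
    (hleaf : ∀ e, a₂ ∈ ends e → e = f) (h2u : a₂ ≠ u) (h2o : a₂ ≠ o) (h21 : a₂ ≠ a₁)
    (h23 : a₂ ≠ a₃) (h2b : a₂ ≠ b) (F : Finset E) (hfF : f ∈ F) (z : Config E) (τ : E → ℕ) :
    typedCount F z τ (K3 ends o a₁ a₂ a₃ b : Config E → Config E → Config E → R) =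
      ∑ p : Bool, ∑ q : Bool, ∑ r : Bool,
        if p.toNat + q.toNat + r.toNat = τ f then
          typedCount (F.erase f) (Function.update z f false) τ
            (fun x y w => ((KBk2 p q r (st ends o a₁ a₂ a₃ b (Function.update x f true))
              (st ends o a₁ a₂ a₃ b (Function.update y f true))
              (st ends o a₁ a₂ a₃ b (Function.update w f true)) : ℤ) : R))
        else 0 := by
  have hst : ∀ (x : Config E) (p : Bool), st ends o a₁ a₂ a₃ b (Function.update x f p) =
      cond p (st ends o a₁ a₂ a₃ b (Function.update x f true))
        (killA2 (st ends o a₁ a₂ a₃ b (Function.update x f true))) := by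
    intro x p
    cases p
    · exact st_update_pendant_a2 ends o a₁ a₂ a₃ b hf hleaf h2u h2o h21 h23 h2b x
    · rfl
  rw [typedCount_split F f hfF]
  refine Finset.sum_congr rfl fun p _ => Finset.sum_congr rfl fun q _ =>
    Finset.sum_congr rfl fun r _ => ?_
  split_ifs
  · refine typedCount_congr_K _ _ _ fun x y w => ?_
    rw [K3_eq_KB, hst x p, hst y q, hst w r]
    rfl
  · rfl

/-- The three placements for `τ f = 1`: the open copy in each slot. -/
theorem typedCount_pendant_a1_one {f : E} {u : V} (hf : ends f = s(a₁, u))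
    (hleaf : ∀ e, a₁ ∈ ends e → e = f) (h1u : a₁ ≠ u) (h1o : a₁ ≠ o) (h12 : a₁ ≠ a₂)
    (h13 : a₁ ≠ a₃) (h1b : a₁ ≠ b) (F : Finset E) (hfF : f ∈ F) (z : Config E) (τ : E → ℕ)
    (hτ : τ f = 1) :
    typedCount F z τ (K3 ends o a₁ a₂ a₃ b : Config E → Config E → Config E → R) =
      typedCount (F.erase f) (Function.update z f false) τ
          (fun x y w => ((KBk1 true false false (st ends o a₁ a₂ a₃ b (Function.update x f true))
            (st ends o a₁ a₂ a₃ b (Function.update y f true))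
            (st ends o a₁ a₂ a₃ b (Function.update w f true)) : ℤ) : R)) +
        typedCount (F.erase f) (Function.update z f false) τ
          (fun x y w => ((KBk1 false true false (st ends o a₁ a₂ a₃ b (Function.update x f true))
            (st ends o a₁ a₂ a₃ b (Function.update y f true))
            (st ends o a₁ a₂ a₃ b (Function.update w f true)) : ℤ) : R)) +
        typedCount (F.erase f) (Function.update z f false) τ
          (fun x y w => ((KBk1 false false true (st ends o a₁ a₂ a₃ b (Function.update x f true))
            (st ends o a₁ a₂ a₃ b (Function.update y f true))
            (st ends o a₁ a₂ a₃ b (Function.update w f true)) : ℤ) : R)) := by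
  rw [typedCount_pendant_a1 ends o a₁ a₂ a₃ b hf hleaf h1u h1o h12 h13 h1b F hfF z τ]
  simp only [Fintype.sum_bool, Bool.toNat_true, Bool.toNat_false, hτ]
  norm_num
  ring

/-- The three placements for `τ f = 2`: the closed copy in each slot. -/
theorem typedCount_pendant_a1_two {f : E} {u : V} (hf : ends f = s(a₁, u))
    (hleaf : ∀ e, a₁ ∈ ends e → e = f) (h1u : a₁ ≠ u) (h1o : a₁ ≠ o) (h12 : a₁ ≠ a₂)
    (h13 : a₁ ≠ a₃) (h1b : a₁ ≠ b) (F : Finset E) (hfF : f ∈ F) (z : Config E) (τ : E → ℕ)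
    (hτ : τ f = 2) :
    typedCount F z τ (K3 ends o a₁ a₂ a₃ b : Config E → Config E → Config E → R) =
      typedCount (F.erase f) (Function.update z f false) τ
          (fun x y w => ((KBk1 false true true (st ends o a₁ a₂ a₃ b (Function.update x f true))
            (st ends o a₁ a₂ a₃ b (Function.update y f true))
            (st ends o a₁ a₂ a₃ b (Function.update w f true)) : ℤ) : R)) +
        typedCount (F.erase f) (Function.update z f false) τ
          (fun x y w => ((KBk1 true false true (st ends o a₁ a₂ a₃ b (Function.update x f true))
            (st ends o a₁ a₂ a₃ b (Function.update y f true))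
            (st ends o a₁ a₂ a₃ b (Function.update w f true)) : ℤ) : R)) +
        typedCount (F.erase f) (Function.update z f false) τ
          (fun x y w => ((KBk1 true true false (st ends o a₁ a₂ a₃ b (Function.update x f true))
            (st ends o a₁ a₂ a₃ b (Function.update y f true))
            (st ends o a₁ a₂ a₃ b (Function.update w f true)) : ℤ) : R)) := by
  rw [typedCount_pendant_a1 ends o a₁ a₂ a₃ b hf hleaf h1u h1o h12 h13 h1b F hfF z τ]
  simp only [Fintype.sum_bool, Bool.toNat_true, Bool.toNat_false, hτ]
  norm_num
  ring

end Identity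

/-! ## One kernel per type, by the copy symmetry -/

section OneKernel

variable {V : Type*} {E : Type*} [Fintype E] [DecidableEq E] {R : Type*} [Field R]
variable (ends : E → Sym2 V) (o a₁ a₂ a₃ b : V)

/-- **Type `1` pendant root, one kernel**: the typed count is the typed count on `G − a₁` of
`KA1one` (types in `{1, 2}` on `F`). -/
theorem typedCount_pendant_a1_eq_KA1one {f : E} {u : V} (hf : ends f = s(a₁, u))
    (hleaf : ∀ e, a₁ ∈ ends e → e = f) (h1u : a₁ ≠ u) (h1o : a₁ ≠ o) (h12 : a₁ ≠ a₂)
    (h13 : a₁ ≠ a₃) (h1b : a₁ ≠ b) (F : Finset E) (hfF : f ∈ F) (z : Config E) (τ : E → ℕ)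
    (hτF : ∀ e ∈ F, τ e = 1 ∨ τ e = 2) (hτ : τ f = 1) :
    typedCount F z τ (K3 ends o a₁ a₂ a₃ b : Config E → Config E → Config E → R) =
      typedCount (F.erase f) (Function.update z f false) τ
        (fun x y w => ((KA1one (st ends o a₁ a₂ a₃ b (Function.update x f true))
          (st ends o a₁ a₂ a₃ b (Function.update y f true))
          (st ends o a₁ a₂ a₃ b (Function.update w f true)) : ℤ) : R)) := by
  set S := fun x : Config E => st ends o a₁ a₂ a₃ b (Function.update x f true) with hS
  have hτ' : ∀ e ∈ F.erase f, τ e = 1 ∨ τ e = 2 := fun e he => hτF e (Finset.mem_of_mem_erase he)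
  rw [typedCount_pendant_a1_one ends o a₁ a₂ a₃ b hf hleaf h1u h1o h12 h13 h1b F hfF z τ hτ]
  have t2 : typedCount (F.erase f) (Function.update z f false) τ
      (fun x y w => ((KBk1 false true false (S x) (S y) (S w) : ℤ) : R)) =
      typedCount (F.erase f) (Function.update z f false) τ
        (fun x y w => ((KB (killA1 (S y)) (S x) (killA1 (S w)) : ℤ) : R)) := by
    rw [← typedCount_swap12 (F.erase f) (Function.update z f false) τ
      (fun x y w => ((KB (killA1 (S y)) (S x) (killA1 (S w)) : ℤ) : R))]
    rfl
  have t3 : typedCount (F.erase f) (Function.update z f false) τ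
      (fun x y w => ((KBk1 false false true (S x) (S y) (S w) : ℤ) : R)) =
      typedCount (F.erase f) (Function.update z f false) τ
        (fun x y w => ((KB (killA1 (S y)) (killA1 (S w)) (S x) : ℤ) : R)) := by
    have s1 := typedCount_swap13 (F.erase f) (Function.update z f false) τ hτ'
      (fun x y w => ((KB (killA1 (S w)) (killA1 (S y)) (S x) : ℤ) : R))
    have s2 := typedCount_swap23 (F.erase f) (Function.update z f false) τ hτ'
      (fun x y w => ((KB (killA1 (S y)) (killA1 (S w)) (S x) : ℤ) : R))
    rw [← s2, ← s1]
    rfl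
  rw [t2, t3, ← typedCount_add', ← typedCount_add']
  refine typedCount_congr_K _ _ _ fun x y w => ?_
  unfold KA1one KBk1
  push_cast
  rfl

/-- **Type `2` pendant root, one kernel**: the typed count is the typed count on `G − a₁` of
`KA1two` (types in `{1, 2}` on `F`). -/
theorem typedCount_pendant_a1_eq_KA1two {f : E} {u : V} (hf : ends f = s(a₁, u))
    (hleaf : ∀ e, a₁ ∈ ends e → e = f) (h1u : a₁ ≠ u) (h1o : a₁ ≠ o) (h12 : a₁ ≠ a₂)
    (h13 : a₁ ≠ a₃) (h1b : a₁ ≠ b) (F : Finset E) (hfF : f ∈ F) (z : Config E) (τ : E → ℕ)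
    (hτF : ∀ e ∈ F, τ e = 1 ∨ τ e = 2) (hτ : τ f = 2) :
    typedCount F z τ (K3 ends o a₁ a₂ a₃ b : Config E → Config E → Config E → R) =
      typedCount (F.erase f) (Function.update z f false) τ
        (fun x y w => ((KA1two (st ends o a₁ a₂ a₃ b (Function.update x f true))
          (st ends o a₁ a₂ a₃ b (Function.update y f true))
          (st ends o a₁ a₂ a₃ b (Function.update w f true)) : ℤ) : R)) := by
  set S := fun x : Config E => st ends o a₁ a₂ a₃ b (Function.update x f true) with hS
  have hτ' : ∀ e ∈ F.erase f, τ e = 1 ∨ τ e = 2 := fun e he => hτF e (Finset.mem_of_mem_erase he)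
  rw [typedCount_pendant_a1_two ends o a₁ a₂ a₃ b hf hleaf h1u h1o h12 h13 h1b F hfF z τ hτ]
  have t2 : typedCount (F.erase f) (Function.update z f false) τ
      (fun x y w => ((KBk1 true false true (S x) (S y) (S w) : ℤ) : R)) =
      typedCount (F.erase f) (Function.update z f false) τ
        (fun x y w => ((KB (S y) (killA1 (S x)) (S w) : ℤ) : R)) := by
    rw [← typedCount_swap12 (F.erase f) (Function.update z f false) τ
      (fun x y w => ((KB (S y) (killA1 (S x)) (S w) : ℤ) : R))]
    rfl
  have t3 : typedCount (F.erase f) (Function.update z f false) τ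
      (fun x y w => ((KBk1 true true false (S x) (S y) (S w) : ℤ) : R)) =
      typedCount (F.erase f) (Function.update z f false) τ
        (fun x y w => ((KB (S y) (S w) (killA1 (S x)) : ℤ) : R)) := by
    have s1 := typedCount_swap13 (F.erase f) (Function.update z f false) τ hτ'
      (fun x y w => ((KB (S w) (S y) (killA1 (S x)) : ℤ) : R))
    have s2 := typedCount_swap23 (F.erase f) (Function.update z f false) τ hτ'
      (fun x y w => ((KB (S y) (S w) (killA1 (S x)) : ℤ) : R))
    rw [← s2, ← s1]
    rfl
  rw [t2, t3, ← typedCount_add', ← typedCount_add']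
  refine typedCount_congr_K _ _ _ fun x y w => ?_
  unfold KA1two KBk1
  push_cast
  rfl

end OneKernel

end TypedRed

end CovForm

end Summit.Ventures.PercRepro2
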